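import Mathlib
import HarnessLib
import Summits.Ventures.LatticeQCDFlow.Scaling.AcceptanceVolumeMonotone
import Summits.Ventures.LatticeQCDFlow.Scaling.AcceptanceVolumeDecayPi
import Summits.Ventures.LatticeQCDFlow.Scaling.AcceptanceVolumeCeilingPi

/-!
# LatticeQCDFlow / Scaling — rigidity of the WORST-BLOCK acceptance ceiling for `m + 1` INDEPENDENT
# BLOCKS on a GENERAL space: `acc(⊗ₖ pₖ, ⊗ₖ qₖ) = acc(pᵢ, qᵢ)` iff every other block is perfect

HONEST FRAMING: exact (Metropolis-corrected) sampling algorithms for lattice gauge theory;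
figures of merit are autocorrelation/cost numbers at stated couplings and volumes; no
continuum-physics claim.

Venture `LatticeQCDFlow` (cell pub-lqcd), topic `Scaling`; FANOUT row 3 (`s0-u1-a`, S0-B
implementation A, GEN-14).  NEW WORK of the cell (elementary measure theory), the multi-block
measure-theoretic form of row 3's finite `accRate_prodLaw_eq_left_iff`
(`Scaling/AcceptanceVolumeCeilingRigidity`) and the equality case of row 3's general-space ceiling
`meanAccept_pi_le_meanAccept_coord` (`Scaling/AcceptanceVolumeCeilingPi`): the `(m+1)`-block
acceptance is the two-block acceptance of (block `i`) ⊗ (the other blocks) along Mathlib's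
measure-preserving split `MeasurableEquiv.piFinSuccAbove … i` (row 3's `Scaling/AcceptanceVolumeMonotone`
did `i = 0`; imported for the block swap and the right/left two-block rigidity of
`Scaling/AcceptanceVolumeCeilingRigidityIntegralEq`), and the two-block rigidity then says: equality
iff the product of the OTHER blocks is perfect — which, by the tensorising Bhattacharyya affinity
(`Scaling/AcceptanceVolumeDecayPi`, imported), means every other block is perfect.  SETTING: `m + 1`
blocks of one block space `Y` (σ-finite laws `μ k`, targets `p k ≥ 0` and models `q k > 0`, both
normalised, `k : Fin (m+1)`), `acc(p, q) = ∫∫ min(p(a)q(b), p(b)q(a))`.  NO definition.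

* §1 bookkeeping: a normalised density gives a probability law (`isProbabilityMeasure_withDensity…`,
  also for the product density on `Measure.pi`); **`prod_ae_eq_prod_pi_iff`** — `⊗pₖ = ⊗qₖ` a.e. iff
  `pₖ = qₖ` a.e. for every block (⇒: the affinities `BCₖ ≤ 1` multiply to `BC(⊗) = 1`);
* §2 **`meanAccept_pi_eq_meanAccept_prod_at`** — for every block `i`,
  `acc(⊗ₖ pₖ, ⊗ₖ qₖ) = acc(pᵢ ⊗ (⊗ⱼ p_{i.succAbove j}), qᵢ ⊗ (⊗ⱼ q_{i.succAbove j}))`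
  (`measurePreserving_piFinSuccAbove`, `Fin.prod_univ_succAbove`);
* §3 **`meanAccept_pi_eq_coord_iff`** — `acc(⊗ₖ pₖ, ⊗ₖ qₖ) = acc(pᵢ, qᵢ) ↔ ∀ j, p_{i.succAbove j} =ᵐ
  q_{i.succAbove j}` (EVERY OTHER BLOCK PERFECT); **`meanAccept_pi_lt_coord`** — one imperfect other
  block makes the worst-block ceiling STRICT; identical blocks `meanAccept_pi_const_eq_one_iff`
  (`acc_{m+1} = acc₁ ↔ m = 0 ∨ p =ᵐ q`).

Reading (value-free): for a flow factorising over independent blocks of a general configuration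
space, the equilibrium acceptance reaches the acceptance of one of its blocks only when all the other
blocks are sampled perfectly; together with row 3's floor and Bhattacharyya rigidity
(`…FloorRigidityPiEq`, `…BhattacharyyaRigidityPi`) all three faces of the multi-block sandwich
`∏ accₖ ≤ acc(⊗) ≤ min(minₖ accₖ, ∏ BCₖ²)` are rigid on general spaces.  NOT CLAIMED: dependent
block types (one common block space `Y`); a quantitative defect; any acceptance of ours; nothing
re-scored.
-/

noncomputable section

namespace Summit.Ventures.LatticeQCDFlow.Theory2

open MeasureTheory Real Set Finset Filter

/-! ## §1 Bookkeeping: probability laws from normalised densities; `⊗pₖ = ⊗qₖ` a.e. block by block -/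

section Bookkeeping

/-- A normalised nonnegative integrable density defines a probability law. [folklore] -/
theorem isProbabilityMeasure_withDensity_of_integral_eq_one {X : Type*} [MeasurableSpace X]
    {μ : Measure X} {q : X → ℝ} (hq0 : ∀ a, 0 ≤ q a) (hqi : Integrable q μ)
    (hq1 : ∫ a, q a ∂μ = 1) :
    IsProbabilityMeasure (μ.withDensity fun a => ENNReal.ofReal (q a)) := by
  refine ⟨?_⟩
  rw [withDensity_apply _ MeasurableSet.univ, Measure.restrict_univ,
    ← ofReal_integral_eq_lintegral_ofReal hqi (Eventually.of_forall hq0), hq1, ENNReal.ofReal_one]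

variable {ι : Type*} [Fintype ι] {X : ι → Type*} [∀ i, MeasurableSpace (X i)]
  {μ : (i : ι) → Measure (X i)} [∀ i, SigmaFinite (μ i)] {p q : (i : ι) → X i → ℝ}

/-- The product of normalised block densities defines a probability law on `Measure.pi`. [folklore] -/
theorem isProbabilityMeasure_pi_withDensity (hq0 : ∀ i a, 0 ≤ q i a) (hqm : ∀ i, Measurable (q i))
    (hqi : ∀ i, Integrable (q i) (μ i)) (hq1 : ∀ i, ∫ a, q i a ∂(μ i) = 1) :
    IsProbabilityMeasure ((Measure.pi μ).withDensity fun x => ENNReal.ofReal (∏ i, q i (x i))) := by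
  obtain ⟨hQ0, -, hQi, hQ1⟩ := piDensity_facts (μ := μ) hq0 hqm hqi
  have hQ1' : ∫ x, ∏ i, q i (x i) ∂(Measure.pi μ) = 1 := by
    rw [hQ1]
    exact prod_eq_one fun i _ => hq1 i
  exact isProbabilityMeasure_withDensity_of_integral_eq_one hQ0 hQi hQ1'

/-- **`⊗pₖ = ⊗qₖ` a.e. IFF EVERY BLOCK IS PERFECT** (normalised nonnegative block densities): `⇐` is
coordinatewise; `⇒`: the Bhattacharyya affinities `BCₖ = ∫ √(pₖ qₖ) ≤ 1` multiply to the affinity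
of the products, which is `1`, so each `BCₖ = 1`, i.e. `pₖ = qₖ` a.e. [ours] -/
theorem prod_ae_eq_prod_pi_iff (hp0 : ∀ i a, 0 ≤ p i a) (hpm : ∀ i, Measurable (p i))
    (hpi : ∀ i, Integrable (p i) (μ i)) (hp1 : ∀ i, ∫ a, p i a ∂(μ i) = 1)
    (hq0 : ∀ i a, 0 ≤ q i a) (hqm : ∀ i, Measurable (q i)) (hqi : ∀ i, Integrable (q i) (μ i))
    (hq1 : ∀ i, ∫ a, q i a ∂(μ i) = 1) :
    (fun x : (i : ι) → X i => ∏ i, p i (x i)) =ᵐ[Measure.pi μ] (fun x => ∏ i, q i (x i))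
      ↔ ∀ i, p i =ᵐ[μ i] q i := by
  classical
  constructor
  · intro h i
    obtain ⟨hP0, hPm, hPi, hP1⟩ := piDensity_facts (μ := μ) hp0 hpm hpi
    obtain ⟨hQ0, hQm, hQi, hQ1⟩ := piDensity_facts (μ := μ) hq0 hqm hqi
    have hP1' : ∫ x, ∏ i, p i (x i) ∂(Measure.pi μ) = 1 := by
      rw [hP1]
      exact prod_eq_one fun i _ => hp1 i
    have hQ1' : ∫ x, ∏ i, q i (x i) ∂(Measure.pi μ) = 1 := by
      rw [hQ1]
      exact prod_eq_one fun i _ => hq1 i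
    have hBC := (integral_sqrt_mul_eq_one_iff (μ := Measure.pi μ) hP0 hPm hPi hP1' hQ0 hQm hQi hQ1').2 h
    rw [integral_sqrt_mul_pi hp0 hq0] at hBC
    have hle : ∀ k, ∫ a, Real.sqrt (p k a * q k a) ∂(μ k) ≤ 1 := fun k =>
      integral_sqrt_mul_le_one (hp0 k) (hpm k) (hpi k) (hp1 k) (hq0 k) (hqm k) (hqi k) (hq1 k)
    have hge : ∀ k, 0 ≤ ∫ a, Real.sqrt (p k a * q k a) ∂(μ k) := fun k =>
      integral_nonneg fun a => Real.sqrt_nonneg _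
    have hBCi : ∫ a, Real.sqrt (p i a * q i a) ∂(μ i) = 1 := by
      by_contra hne
      have hlt : ∫ a, Real.sqrt (p i a * q i a) ∂(μ i) < 1 := lt_of_le_of_ne (hle i) hne
      have hprod : ∏ k, ∫ a, Real.sqrt (p k a * q k a) ∂(μ k) < 1 := by
        rw [← mul_prod_erase univ _ (mem_univ i)]
        calc (∫ a, Real.sqrt (p i a * q i a) ∂(μ i))
              * ∏ k ∈ univ.erase i, ∫ a, Real.sqrt (p k a * q k a) ∂(μ k)
            ≤ (∫ a, Real.sqrt (p i a * q i a) ∂(μ i)) * 1 :=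
              mul_le_mul_of_nonneg_left (prod_le_one (fun k _ => hge k) fun k _ => hle k) (hge i)
          _ < 1 := by rw [mul_one]; exact hlt
      exact hprod.ne hBC
    exact (integral_sqrt_mul_eq_one_iff (hp0 i) (hpm i) (hpi i) (hp1 i) (hq0 i) (hqm i) (hqi i)
      (hq1 i)).1 hBCi
  · intro h
    have hx : ∀ i, ∀ᵐ x ∂(Measure.pi μ), p i (x i) = q i (x i) :=
      fun i => (Measure.tendsto_eval_ae_ae (μ := μ) (i := i)).eventually (h i)
    filter_upwards [eventually_all.2 hx] with x hx
    exact prod_congr rfl fun i _ => hx i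

end Bookkeeping

/-! ## §2 `m + 1` blocks = (block `i`) ⊗ (the other blocks), for every `i` -/

section Blocks

variable {Y : Type*} [MeasurableSpace Y] {m : ℕ} {μ : Fin (m + 1) → Measure Y}
  [∀ i, SigmaFinite (μ i)] {p q : Fin (m + 1) → Y → ℝ}

/-- Splitting off block `i`: the product density at the re-assembled configuration. [folklore] -/
theorem prod_piFinSuccAbove_symm_at (f : Fin (m + 1) → Y → ℝ) (i : Fin (m + 1))
    (z : Y × (Fin m → Y)) :
    ∏ k, f k ((MeasurableEquiv.piFinSuccAbove (fun _ : Fin (m + 1) => Y) i).symm z k)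
      = f i z.1 * ∏ j : Fin m, f (i.succAbove j) (z.2 j) := by
  rw [Fin.prod_univ_succAbove _ i]
  simp [MeasurableEquiv.piFinSuccAbove, Fin.insertNthEquiv]

/-- **THE `(m+1)`-BLOCK ACCEPTANCE IS THE TWO-BLOCK ACCEPTANCE OF (BLOCK `i`) ⊗ (THE OTHERS)**, for
every block `i`. [ours] -/
theorem meanAccept_pi_eq_meanAccept_prod_at (p q : Fin (m + 1) → Y → ℝ) (i : Fin (m + 1)) :
    ∫ x, ∫ x', min ((∏ k, p k (x k)) * ∏ k, q k (x' k)) ((∏ k, p k (x' k)) * ∏ k, q k (x k))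
        ∂(Measure.pi μ) ∂(Measure.pi μ)
      = ∫ z, ∫ z', min (p i z.1 * (∏ j : Fin m, p (i.succAbove j) (z.2 j))
            * (q i z'.1 * ∏ j : Fin m, q (i.succAbove j) (z'.2 j)))
          (p i z'.1 * (∏ j : Fin m, p (i.succAbove j) (z'.2 j))
            * (q i z.1 * ∏ j : Fin m, q (i.succAbove j) (z.2 j)))
          ∂((μ i).prod (Measure.pi fun j : Fin m => μ (i.succAbove j)))
          ∂((μ i).prod (Measure.pi fun j : Fin m => μ (i.succAbove j))) := by
  have hE := (measurePreserving_piFinSuccAbove μ i).symm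
    (MeasurableEquiv.piFinSuccAbove (fun _ : Fin (m + 1) => Y) i)
  rw [← hE.integral_comp']
  refine integral_congr_ae (Eventually.of_forall fun z => ?_)
  dsimp only
  rw [← hE.integral_comp']
  refine integral_congr_ae (Eventually.of_forall fun z' => ?_)
  dsimp only
  rw [prod_piFinSuccAbove_symm_at, prod_piFinSuccAbove_symm_at, prod_piFinSuccAbove_symm_at,
    prod_piFinSuccAbove_symm_at]

/-! ## §3 The worst-block ceiling is attained only when every other block is perfect -/

/-- **RIGIDITY OF THE WORST-BLOCK CEILING FOR `m + 1` INDEPENDENT BLOCKS (general space)**: for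
normalised nonnegative block targets and positive normalised block models on one σ-finite block space,
`acc(⊗ₖ pₖ, ⊗ₖ qₖ) = acc(pᵢ, qᵢ)` iff every other block is perfect,
`p_{i.succAbove j} = q_{i.succAbove j}` a.e. for all `j`. [ours] -/
theorem meanAccept_pi_eq_coord_iff (hp0 : ∀ k a, 0 ≤ p k a) (hpm : ∀ k, Measurable (p k))
    (hpi : ∀ k, Integrable (p k) (μ k)) (hp1 : ∀ k, ∫ a, p k a ∂(μ k) = 1)
    (hq0 : ∀ k a, 0 < q k a) (hqm : ∀ k, Measurable (q k)) (hqi : ∀ k, Integrable (q k) (μ k))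
    (hq1 : ∀ k, ∫ a, q k a ∂(μ k) = 1) (i : Fin (m + 1)) :
    ∫ x, ∫ x', min ((∏ k, p k (x k)) * ∏ k, q k (x' k)) ((∏ k, p k (x' k)) * ∏ k, q k (x k))
        ∂(Measure.pi μ) ∂(Measure.pi μ)
        = ∫ a, ∫ b, min (p i a * q i b) (p i b * q i a) ∂(μ i) ∂(μ i)
      ↔ ∀ j : Fin m, p (i.succAbove j) =ᵐ[μ (i.succAbove j)] q (i.succAbove j) := by
  have hq0' : ∀ k a, 0 ≤ q k a := fun k a => (hq0 k a).le
  obtain ⟨hP0, hPm, hPi, hP1⟩ := piDensity_facts (μ := fun j : Fin m => μ (i.succAbove j))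
    (p := fun j => p (i.succAbove j)) (fun j => hp0 _) (fun j => hpm _) fun j => hpi _
  obtain ⟨-, hQm, hQi, -⟩ := piDensity_facts (μ := fun j : Fin m => μ (i.succAbove j))
    (p := fun j => q (i.succAbove j)) (fun j => hq0' _) (fun j => hqm _) fun j => hqi _
  have hP1' : ∫ y, ∏ j : Fin m, p (i.succAbove j) (y j)
      ∂(Measure.pi fun j : Fin m => μ (i.succAbove j)) = 1 := by
    rw [hP1]
    exact prod_eq_one fun j _ => hp1 _
  have hQ0 : ∀ y : Fin m → Y, 0 < ∏ j : Fin m, q (i.succAbove j) (y j) :=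
    fun y => prod_pos fun j _ => hq0 _ (y j)
  haveI := isProbabilityMeasure_withDensity_of_integral_eq_one (hq0' i) (hqi i) (hq1 i)
  haveI := isProbabilityMeasure_pi_withDensity (μ := fun j : Fin m => μ (i.succAbove j))
    (q := fun j => q (i.succAbove j)) (fun j => hq0' _) (fun j => hqm _) (fun j => hqi _)
    fun j => hq1 _
  rw [meanAccept_pi_eq_meanAccept_prod_at p q i,
    meanAccept_prod_eq_meanAccept_left_iff (hp0 i) (hpm i) (hpi i) (hp1 i) (hq0 i) (hqm i) (hqi i)
      hP0 hPm hPi hP1' hQ0 hQm hQi,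
    prod_ae_eq_prod_pi_iff (μ := fun j : Fin m => μ (i.succAbove j)) (fun j => hp0 _) (fun j => hpm _)
      (fun j => hpi _) (fun j => hp1 _) (fun j => hq0' _) (fun j => hqm _) (fun j => hqi _)
      fun j => hq1 _]

/-- **ONE IMPERFECT OTHER BLOCK MAKES THE WORST-BLOCK CEILING STRICT**:
`acc(⊗ₖ pₖ, ⊗ₖ qₖ) < acc(pᵢ, qᵢ)` if some block `i.succAbove j` is imperfect. [ours] -/
theorem meanAccept_pi_lt_coord (hp0 : ∀ k a, 0 ≤ p k a) (hpm : ∀ k, Measurable (p k))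
    (hpi : ∀ k, Integrable (p k) (μ k)) (hp1 : ∀ k, ∫ a, p k a ∂(μ k) = 1)
    (hq0 : ∀ k a, 0 < q k a) (hqm : ∀ k, Measurable (q k)) (hqi : ∀ k, Integrable (q k) (μ k))
    (hq1 : ∀ k, ∫ a, q k a ∂(μ k) = 1) (i : Fin (m + 1)) {j : Fin m}
    (hj : ¬ p (i.succAbove j) =ᵐ[μ (i.succAbove j)] q (i.succAbove j)) :
    ∫ x, ∫ x', min ((∏ k, p k (x k)) * ∏ k, q k (x' k)) ((∏ k, p k (x' k)) * ∏ k, q k (x k))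
        ∂(Measure.pi μ) ∂(Measure.pi μ)
      < ∫ a, ∫ b, min (p i a * q i b) (p i b * q i a) ∂(μ i) ∂(μ i) := by
  refine lt_of_le_of_ne (meanAccept_pi_le_meanAccept_coord hp0 hpm hpi hp1
    (fun k a => (hq0 k a).le) hqm hqi hq1 i) fun heq => ?_
  exact hj ((meanAccept_pi_eq_coord_iff hp0 hpm hpi hp1 hq0 hqm hqi hq1 i).1 heq j)

end Blocks

/-! ## Identical blocks -/

section Const

variable {Y : Type*} [MeasurableSpace Y] {ν : Measure Y} [SigmaFinite ν] {p q : Y → ℝ}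

/-- **Identical blocks**: for `m + 1` independent copies of one block flow,
`acc(p^{⊗(m+1)}, q^{⊗(m+1)}) = acc(p, q)` iff `m = 0` or the block flow is perfect. [ours] -/
theorem meanAccept_pi_const_eq_one_iff {m : ℕ} (hp0 : ∀ a, 0 ≤ p a) (hpm : Measurable p)
    (hpi : Integrable p ν) (hp1 : ∫ a, p a ∂ν = 1) (hq0 : ∀ a, 0 < q a) (hqm : Measurable q)
    (hqi : Integrable q ν) (hq1 : ∫ a, q a ∂ν = 1) :
    ∫ x, ∫ x', min ((∏ k : Fin (m + 1), p (x k)) * ∏ k, q (x' k)) ((∏ k, p (x' k)) * ∏ k, q (x k))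
        ∂(Measure.pi fun _ : Fin (m + 1) => ν) ∂(Measure.pi fun _ : Fin (m + 1) => ν)
        = ∫ a, ∫ b, min (p a * q b) (p b * q a) ∂ν ∂ν
      ↔ m = 0 ∨ p =ᵐ[ν] q := by
  rw [meanAccept_pi_eq_coord_iff (μ := fun _ : Fin (m + 1) => ν) (p := fun _ => p) (q := fun _ => q)
    (fun _ => hp0) (fun _ => hpm) (fun _ => hpi) (fun _ => hp1) (fun _ => hq0) (fun _ => hqm)
    (fun _ => hqi) (fun _ => hq1) 0]
  constructor
  · intro h
    rcases Nat.eq_zero_or_pos m with hm | hm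
    · exact Or.inl hm
    · exact Or.inr (h ⟨0, hm⟩)
  · rintro (hm | h) j
    · exact absurd j.isLt (by omega)
    · exact h

/-- **Identical imperfect blocks**: `acc(p^{⊗(m+1)}, q^{⊗(m+1)}) < acc(p, q)` for `m ≥ 1` copies of an
imperfect block flow. [ours] -/
theorem meanAccept_pi_const_lt_one {m : ℕ} (hm : 0 < m) (hp0 : ∀ a, 0 ≤ p a) (hpm : Measurable p)
    (hpi : Integrable p ν) (hp1 : ∫ a, p a ∂ν = 1) (hq0 : ∀ a, 0 < q a) (hqm : Measurable q)
    (hqi : Integrable q ν) (hq1 : ∫ a, q a ∂ν = 1) (h : ¬ p =ᵐ[ν] q) :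
    ∫ x, ∫ x', min ((∏ k : Fin (m + 1), p (x k)) * ∏ k, q (x' k)) ((∏ k, p (x' k)) * ∏ k, q (x k))
        ∂(Measure.pi fun _ : Fin (m + 1) => ν) ∂(Measure.pi fun _ : Fin (m + 1) => ν)
      < ∫ a, ∫ b, min (p a * q b) (p b * q a) ∂ν ∂ν :=
  meanAccept_pi_lt_coord (μ := fun _ : Fin (m + 1) => ν) (p := fun _ => p) (q := fun _ => q)
    (fun _ => hp0) (fun _ => hpm) (fun _ => hpi) (fun _ => hp1) (fun _ => hq0) (fun _ => hqm)
    (fun _ => hqi) (fun _ => hq1) 0 (j := ⟨0, hm⟩) h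

end Const

end Summit.Ventures.LatticeQCDFlow.Theory2
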